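import Literature.NumberTheory.EllipticCurves.IwasawaNakayamaProofs
import Literature.NumberTheory.EllipticCurves.IwasawaDualLayerCoinvariantsProofs
import Literature.NumberTheory.EllipticCurves.IwasawaAlgebraLiftingExponentProofs
import Literature.NumberTheory.EllipticCurves.IwasawaAlgebraSpecializationTorsionCountProofs
import HarnessLib

/-!
# Input (R1) of road T / road Λ to item 23110 (`(H⁺)^∨ ≅ Λ` at `2`, Kim 2007 Prop. 3.17), the DUAL-SIDE algebra in the tree's
# untopologised Pontryagin setting `IwasawaDual.IsDualPair`: the dual of a `p`-DIVISIBLE discrete `Λ`-module `S` with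
# `#S[𝔪] ≤ p` and `S[p]` INFINITE is free of rank one

Routes `ResidualThetaTransportAtTwo` (RTT, crux r201 `ResidualLambdaFormulaNegDiscAtTwo`, stmt-BirchSwinnertonDyer-23110) /
`ThetaPartnerAtTwo`. Seat `prover-bsd-wall-tp2-p2x-w2` g15; `--supports stmt-BirchSwinnertonDyer-23110`. THEOREMS ONLY, PURE ALGEBRA
(no definition, no named fact, no `sorry`); nothing about any curve is asserted.

WHY (lead memo RLF-TWIST-ROAD-g12 §3 (R1); w2 g14's `…CyclicLambdaModuleFree` is the rank-currency form). For the discrete module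
`S = H⁺ = E⁺_∞ ⊗ ℚ₂/ℤ₂` with `φ = conj_γ`, `ψ = φ − 1`, the three inputs are POINT-LEVEL facts about `A = ⋃ₙ E⁺(ℚ_{2,n})`:
`S` is `p`-divisible (free: a tensor with `ℚ_p/ℤ_p`), `S[𝔪] = (A/pA)^{γ}` has `≤ p` elements (CYC⁺, K4 `plusCyclic_of_honda`), and
`S[p] = A/pA` is infinite (rank growth of `E⁺(ℚ_{2,n})`, from `Col⁺` onto at `2`). THIS FILE is the algebra turning them into
`X ≃ₗ[Λ] Λ` for EVERY dual pair `(X, toDual)` of `(S, ψ)` (`toDual : X ≃ Hom(S, ℚ/ℤ)`, `T ↔ ψ`), with NO rank / cardinal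
bookkeeping and no `T`-torsion clause:

* §1 `span_eq_top_of_sup_mPow_one_eq_top` — NAKAYAMA for a finite family: `⟨rep⟩_Λ + (pX + TX) = X ⟹ ⟨rep⟩_Λ = X` (the
  compactness-of-`Λ^ι` argument of the tree's `IsDualPair.module_finite`, run for a GIVEN family).
* §2 `exists_span_singleton_eq_top_of_card_piece_le` — CYCLICITY: if `S[𝔪] = {s : p s = 0, ψ s = 0}` is finite with `≤ p`
  elements then `X = Λ·x₀`: the restriction `X → Hom(S[𝔪], ℚ/ℤ)` has image of order `≤ #S[𝔪] ≤ p` (`#Hom(A,ℚ/ℤ) = #A`) and killed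
  by `p`, hence cyclic (`addOrderOf_eq_prime`, `AddSubgroup.eq_of_le_of_card_ge`); its kernel is `X⁽¹⁾ ⊆ pX + TX`
  (`IsDualPair.mem_mPow_one_of_mem_annPiece`); then §1.
* §3 `eq_zero_of_nsmul_eq_zero_of_divisible` — `S` `p`-divisible ⟹ `X` has no `p`-torsion (`toDual (p x) s = toDual x (p s)`).
* §4 `finite_quotient_span_sup_span_natCast` — `Λ/(g, p)` is finite when some coefficient of `g` is prime to `p`
  (`g = X^d v + p w`, `v` a unit, so `(g, p) ⊇ (X^d, X^{d+1} + p)`, of index `p^d`: tree `finite_quotient_span_X_pow_sup_span`).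
* §5 **`nonempty_linearEquiv_of_card_piece_le_of_divisible_of_infinite`** — the theorem: `X = Λ x₀` (§2); if `0 ≠ f` kills `x₀`,
  `f = p^m g` with a unit coefficient in `g` (`exists_eq_pow_mul_of_ne_zero`), `g x₀ = 0` (§3), so `X/pX` is a quotient of `Λ/(g,p)`,
  finite (§4), and `S[p] ≅ (X/pX)^∨` is finite (`IsDualPair.finite_quotient_iff_of_smul`) — contradiction; hence `ann(x₀) = 0` and
  `X ≃ₗ[Λ] Λ`. Corollary `…_of_generator_…` with `S[𝔪] ⊆ ℕ·e` for one `p`-torsion `e` (the shape CYC⁺ delivers).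

HONEST FRAMING: closes nothing; the POINT-LEVEL inputs at `2` are separate files; 23110 is NOT proved; BSD is not proved by any of this.
References: [BDKim2007] B. D. Kim, Compositio Math. 143 (2007) Prop. 3.17; [BDKim2013] Props. 2.2–2.3; [Lang1990] Ch. 5 §1 (Nakayama
for compact `Λ`-modules); [Washington1997] §7.1, §13.2–13.3; [GreenbergLNM1716] §1 p. 60.
-/

set_option autoImplicit false
-- D-0017: single-problem summit, so `Summit.BirchSwinnertonDyer.BirchSwinnertonDyer.…` repeats a namespace BY DESIGN.
set_option linter.dupNamespace false

noncomputable section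

open scoped Classical
open Literature.NumberTheory.EllipticCurves Literature.NumberTheory.EllipticCurves.IwasawaDual

namespace Summit.BirchSwinnertonDyer.BirchSwinnertonDyer.Theorems.ResidualThetaLayer.PlusDual

variable {p : ℕ} [Fact p.Prime]
variable {S : Type*} [AddCommGroup S] {ψ : AddMonoid.End S}
variable {X : Type*} [AddCommGroup X] [Module (PowerSeries ℤ_[p]) X]
variable {toDual : X →+ (S →+ AddCircle (1 : ℚ))}

/-! ## §1 Nakayama for a given finite family -/

open scoped PowerSeries.WithPiTopology in
/-- **Nakayama for Pontryagin duals, given family**: for a dual pair `(X, toDual)` of `(S, ψ)` and a finite family `rep : ι → X`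
with `⟨rep⟩_Λ + (pX + TX) = X`, already `⟨rep⟩_Λ = X` (bootstrapping `⟨rep⟩ + M_{2n} = X`, `M_{2n} ⊆ X⁽ⁿ⁾`, compactness of `Λ^ι`
over the clopen congruence classes, `⋂ X⁽ⁿ⁾ = 0`). [cite: Lang1990, Ch. 5 §1 (Nakayama's lemma (ii))] -/
theorem span_eq_top_of_sup_mPow_one_eq_top (h : IsDualPair p ψ toDual) {ι : Type*} [Fintype ι] (rep : ι → X)
    (h1 : (Submodule.span (PowerSeries ℤ_[p]) (Set.range rep)).toAddSubgroup ⊔ mPow p 1 = ⊤) :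
    Submodule.span (PowerSeries ℤ_[p]) (Set.range rep) = ⊤ := by
  classical
  set N : Submodule (PowerSeries ℤ_[p]) X := Submodule.span (PowerSeries ℤ_[p]) (Set.range rep) with hN
  -- `N + X⁽ⁿ⁾ = X` with explicit coefficients
  have h2 : ∀ (n : ℕ) (x : X), ∃ a : ι → PowerSeries ℤ_[p], x - ∑ i, a i • rep i ∈ annPiece p ψ toDual n := by
    intro n x
    have hx : x ∈ N.toAddSubgroup ⊔ mPow p (2 * n) :=
      (IsDualPair.sup_mPow_eq_top N h1 (2 * n)) ▸ AddSubgroup.mem_top x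
    obtain ⟨ν, hν, m, hm, rfl⟩ := AddSubgroup.mem_sup.mp hx
    obtain ⟨a, ha⟩ := (Submodule.mem_span_range_iff_exists_fun _).mp hν
    refine ⟨a, ?_⟩
    rw [ha, add_sub_cancel_left]
    exact h.mPow_le_annPiece n hm
  -- compactness of `Λ^ι`
  haveI : CompactSpace (PowerSeries ℤ_[p]) := inferInstanceAs (CompactSpace ((Unit →₀ ℕ) → ℤ_[p]))
  have hgen : ∀ x : X, x ∈ N := by
    intro x
    let A : ℕ → Set (ι → PowerSeries ℤ_[p]) := fun n ↦ {a | x - ∑ i, a i • rep i ∈ annPiece p ψ toDual n}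
    have hstab : ∀ n a a', a ∈ A n → Cong n a a' → a' ∈ A n := by
      intro n a a' ha hc
      have := AddSubgroup.add_mem _ ha (h.sum_smul_sub_mem_annPiece hc rep)
      simp only [A, Set.mem_setOf_eq]
      convert this using 1
      abel
    have hopen : ∀ n, IsOpen (A n) := by
      intro n
      rw [isOpen_iff_forall_mem_open]
      intro a ha
      exact ⟨{a' | Cong n a a'}, fun a' ha' ↦ hstab n a a' ha ha', isOpen_setOf_cong n a, Cong.refl n a⟩
    have hclosed : ∀ n, IsClosed (A n) := by
      intro n
      rw [← isOpen_compl_iff, isOpen_iff_forall_mem_open]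
      intro a ha
      refine ⟨{a' | Cong n a a'}, fun a' ha' h' ↦ ha (hstab n a' a h' (Cong.symm ha')), isOpen_setOf_cong n a,
        Cong.refl n a⟩
    have hanti : ∀ n, A (n + 1) ⊆ A n := fun n a ha ↦ annPiece_anti (Nat.le_succ n) ha
    have hne : ∀ n, (A n).Nonempty := fun n ↦ h2 n x
    obtain ⟨a, ha⟩ := IsCompact.nonempty_iInter_of_sequence_nonempty_isCompact_isClosed A hanti hne
      (hclosed 0).isCompact hclosed
    have hz : x - ∑ i, a i • rep i = 0 := h.eq_zero_of_forall_mem_annPiece fun n ↦ Set.mem_iInter.mp ha n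
    rw [sub_eq_zero] at hz
    rw [hz]
    exact Submodule.sum_mem _ fun i _ ↦ Submodule.smul_mem _ _ (Submodule.subset_span ⟨i, rfl⟩)
  exact eq_top_iff.mpr fun x _ ↦ hgen x

/-! ## §2 Cyclicity from `#S[𝔪] ≤ p` -/

/-- **`X` is cyclic when `S[𝔪] = {s : p s = 0 ∧ ψ s = 0}` is finite of order `≤ p`.** The restriction map
`ρ : X → Hom(S[𝔪], ℚ/ℤ)` has image `Q` of order `≤ #Hom(S[𝔪], ℚ/ℤ) = #S[𝔪] ≤ p` killed by `p`; such a group is `ℤ·q₀` for one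
`q₀ = ρ x₀` (an element of prime order generates); `ker ρ = X⁽¹⁾ ⊆ pX + TX`, so `Λx₀ + (pX + TX) = X` and §1 concludes.
[cite: Lang1990, Ch. 5 §1] [cite: GreenbergLNM1716, §1 p. 60] -/
theorem exists_span_singleton_eq_top_of_card_piece_le (h : IsDualPair p ψ toDual)
    (hfin : (piece p ψ 1 : Set S).Finite) (hcard : Nat.card (piece p ψ 1) ≤ p) :
    ∃ x₀ : X, Submodule.span (PowerSeries ℤ_[p]) {x₀} = ⊤ := by
  classical
  have hp : p.Prime := Fact.out
  set P : AddSubgroup S := piece p ψ 1 with hPdef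
  haveI : Finite P := hfin.to_subtype
  -- the restriction map `ρ : X → Hom(P, ℚ/ℤ)`
  let ρ : X →+ (P →+ AddCircle (1 : ℚ)) :=
    { toFun := fun x ↦ (toDual x).comp P.subtype
      map_zero' := by rw [map_zero, AddMonoidHom.zero_comp]
      map_add' := fun x y ↦ by rw [map_add, AddMonoidHom.add_comp] }
  have hρ : ∀ (x : X) (s : P), ρ x s = toDual x s := fun _ _ ↦ rfl
  -- `p` kills the image
  have hpρ : ∀ x : X, p • ρ x = 0 := by
    intro x
    ext s
    have hs : p ^ 1 • (s : S) = 0 := s.2.1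
    rw [pow_one] at hs
    rw [AddMonoidHom.nsmul_apply, hρ, ← map_nsmul, ← AddSubgroupClass.coe_nsmul, AddMonoidHom.zero_apply,
      show ((p • s : P) : S) = p • (s : S) from rfl, hs, map_zero]
  -- the image is `ℤ · ρ x₁` for some `x₁`
  have hgen : ∃ x₁ : X, ∀ x : X, ∃ k : ℤ, k • ρ x₁ = ρ x := by
    by_cases hex : ∃ x₁ : X, ρ x₁ ≠ 0
    · obtain ⟨x₁, hx₁⟩ := hex
      refine ⟨x₁, fun x ↦ ?_⟩
      haveI : Finite (P →+ AddCircle (1 : ℚ)) := PontryaginCard.finite_characterModule_of_finite P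
      have hord : addOrderOf (ρ x₁) = p := addOrderOf_eq_prime (hpρ x₁) hx₁
      have hZ : AddSubgroup.zmultiples (ρ x₁) = ρ.range := by
        apply AddSubgroup.eq_of_le_of_card_ge
        · exact AddSubgroup.zmultiples_le_of_mem ⟨x₁, rfl⟩
        · calc Nat.card ρ.range ≤ Nat.card (P →+ AddCircle (1 : ℚ)) := AddSubgroup.card_le_card_addGroup _
            _ = Nat.card P := PontryaginCard.natCard_characterModule P
            _ ≤ p := hcard
            _ = Nat.card (AddSubgroup.zmultiples (ρ x₁)) := by rw [Nat.card_zmultiples, hord]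
      have hx : ρ x ∈ AddSubgroup.zmultiples (ρ x₁) := by rw [hZ]; exact ⟨x, rfl⟩
      exact AddSubgroup.mem_zmultiples_iff.mp hx
    · simp only [ne_eq, not_exists, not_not] at hex
      exact ⟨0, fun x ↦ ⟨0, by rw [zero_zsmul, hex x]⟩⟩
  obtain ⟨x₁, hx₁⟩ := hgen
  refine ⟨x₁, span_eq_top_of_sup_mPow_one_eq_top h (fun _ : Unit ↦ x₁) ?_ |>.symm ▸ ?_⟩
  · -- `Λ x₁ + M_1 = X`
    rw [eq_top_iff]
    intro x _
    obtain ⟨k, hk⟩ := hx₁ x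
    have hann : x - k • x₁ ∈ annPiece p ψ toDual 1 := by
      intro s hs
      have e := congrArg (fun f : P →+ AddCircle (1 : ℚ) ↦ f ⟨s, hs⟩) hk
      simp only [AddMonoidHom.zsmul_apply, hρ] at e
      rw [map_sub, AddMonoidHom.sub_apply, map_zsmul, AddMonoidHom.zsmul_apply, sub_eq_zero, e]
    have hmem : k • x₁ ∈ (Submodule.span (PowerSeries ℤ_[p]) (Set.range fun _ : Unit ↦ x₁)).toAddSubgroup :=
      AddSubgroup.zsmul_mem _ (show x₁ ∈ (Submodule.span (PowerSeries ℤ_[p]) (Set.range fun _ : Unit ↦ x₁)).toAddSubgroup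
        from Submodule.subset_span ⟨(), rfl⟩) k
    have := AddSubgroup.add_mem _ (AddSubgroup.mem_sup_left hmem)
      (AddSubgroup.mem_sup_right (h.mem_mPow_one_of_mem_annPiece hann))
    rwa [add_sub_cancel] at this
  · rw [Set.range_const]

/-! ## §3 Divisibility of `S` ⟹ no `p`-torsion in `X` -/

/-- **If `S` is `p`-divisible then `X` has no `p`-torsion**: `toDual (p • x) (t) = toDual x (p • t)`, and every `s = p • t`.
[cite: GreenbergLNM1716, §1 p. 60] -/
theorem eq_zero_of_nsmul_eq_zero_of_divisible (h : IsDualPair p ψ toDual) (hdiv : ∀ s : S, ∃ t : S, p • t = s)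
    {x : X} (hx : p • x = 0) : x = 0 := by
  apply h.bijective.1
  rw [map_zero]
  ext s
  obtain ⟨t, rfl⟩ := hdiv s
  rw [AddMonoidHom.zero_apply, ← nsmul_eval, hx, map_zero, AddMonoidHom.zero_apply]

/-- Iterated form: `(p : Λ)^m • y = 0 ⟹ y = 0` when `S` is `p`-divisible. [cite: GreenbergLNM1716, §1 p. 60] -/
theorem eq_zero_of_pow_smul_eq_zero_of_divisible (h : IsDualPair p ψ toDual) (hdiv : ∀ s : S, ∃ t : S, p • t = s)
    (m : ℕ) {y : X} (hy : ((p : PowerSeries ℤ_[p]) ^ m) • y = 0) : y = 0 := by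
  induction m generalizing y with
  | zero => simpa using hy
  | succ m ih =>
    apply ih
    apply eq_zero_of_nsmul_eq_zero_of_divisible h hdiv
    rw [← Nat.cast_smul_eq_nsmul (PowerSeries ℤ_[p]), smul_smul, ← pow_succ', hy]

/-! ## §4 `Λ/(g, p)` is finite when `g` has a coefficient prime to `p` -/

/-- **`Λ/(g, p)` is finite when some coefficient of `g` is prime to `p`**: `g = X^d·v + p·w` with `v ∈ Λˣ`
(`exists_eq_X_pow_mul_add_mul`), so `(g, p) ⊇ (X^d, X^{d+1} + p)`, an ideal of index `p^d` (`finite_quotient_span_X_pow_sup_span`).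
[cite: Washington1997, §7.1 (proof of Thm. 7.3) and Prop. 13.8] -/
theorem finite_quotient_span_sup_span_natCast {g : PowerSeries ℤ_[p]} (hg : ∃ i, ¬ (p : ℤ_[p]) ∣ PowerSeries.coeff i g) :
    Finite (PowerSeries ℤ_[p] ⧸ (Ideal.span {g} ⊔ Ideal.span {(p : PowerSeries ℤ_[p])})) := by
  obtain ⟨d, v, w, hv, hgvw⟩ := IwasawaAlgebra.exists_eq_X_pow_mul_add_mul p hg
  set J : Ideal (PowerSeries ℤ_[p]) := Ideal.span {g} ⊔ Ideal.span {(p : PowerSeries ℤ_[p])} with hJ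
  haveI := IwasawaAlgebra.finite_quotient_span_X_pow_sup_span p (k := d) (m := d + 1) (Nat.lt_succ_self d)
  have hp_mem : (p : PowerSeries ℤ_[p]) ∈ J := Ideal.mem_sup_right (Ideal.mem_span_singleton_self _)
  have hXd : (PowerSeries.X : PowerSeries ℤ_[p]) ^ d ∈ J := by
    obtain ⟨u, rfl⟩ := hv
    have e : (PowerSeries.X : PowerSeries ℤ_[p]) ^ d = ↑u⁻¹ * (g - (p : PowerSeries ℤ_[p]) * w) := by
      rw [hgvw, add_sub_cancel_right, mul_comm, mul_assoc, Units.mul_inv, mul_one]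
    rw [e]
    exact J.mul_mem_left _ (J.sub_mem (Ideal.mem_sup_left (Ideal.mem_span_singleton_self g)) (J.mul_mem_right _ hp_mem))
  have hle : Ideal.span {(PowerSeries.X : PowerSeries ℤ_[p]) ^ d} ⊔
      Ideal.span {(PowerSeries.X ^ (d + 1) + PowerSeries.C (p : ℤ_[p]) : PowerSeries ℤ_[p])} ≤ J := by
    refine sup_le ((Ideal.span_singleton_le_iff_mem _).mpr hXd) ((Ideal.span_singleton_le_iff_mem _).mpr ?_)
    rw [map_natCast, pow_succ]
    exact J.add_mem (J.mul_mem_right _ hXd) hp_mem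
  exact Finite.of_surjective _ (Ideal.Quotient.factor_surjective hle)

/-! ## §5 The theorem -/

/-- **The Pontryagin dual of a `p`-divisible discrete `Λ`-module `S` with `#S[𝔪] ≤ p` and `S[p]` infinite is free of rank one.**
For a dual pair `(X, toDual)` of `(S, ψ)` (`IwasawaDual.IsDualPair`: `toDual : X ≃ Hom(S, ℚ/ℤ)`, `T ↔ ψ`, constants through
`ℤ_p → ℤ/p^k`, `(p, ψ)` locally nilpotent) such that `S[𝔪] = {s : p s = 0 ∧ ψ s = 0}` is finite with at most `p` elements, every
`s ∈ S` is `p • t`, and `S[p]` is infinite: `X ≃ₗ[Λ] Λ`. (§2: `X = Λx₀`; were `0 ≠ f ∈ ann(x₀)`, write `f = p^m g` with a unit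
coefficient in `g`; §3 gives `g x₀ = 0`, so `X/pX` is a quotient of the finite `Λ/(g, p)` (§4) and `S[p] ≅ (X/pX)^∨`
(`IsDualPair.finite_quotient_iff_of_smul`) would be finite.) For `S = E^±_∞ ⊗ ℚ_p/ℤ_p` this is `(E^±(k_∞) ⊗ ℚ_p/ℤ_p)^∨ ≅ Λ`.
[cite: BDKim2007, Prop. 3.17] [cite: BDKim2013, Props. 2.2–2.3] [cite: Washington1997, §13.2] -/
theorem nonempty_linearEquiv_of_card_piece_le_of_divisible_of_infinite (h : IsDualPair p ψ toDual)
    (hfin : (piece p ψ 1 : Set S).Finite) (hcard : Nat.card (piece p ψ 1) ≤ p)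
    (hdiv : ∀ s : S, ∃ t : S, p • t = s) (hinf : {s : S | p • s = 0}.Infinite) :
    Nonempty (X ≃ₗ[PowerSeries ℤ_[p]] PowerSeries ℤ_[p]) := by
  classical
  obtain ⟨x₀, hx₀⟩ := exists_span_singleton_eq_top_of_card_piece_le h hfin hcard
  let φ : PowerSeries ℤ_[p] →ₗ[PowerSeries ℤ_[p]] X := LinearMap.toSpanSingleton (PowerSeries ℤ_[p]) X x₀
  have hφsurj : Function.Surjective φ := by
    rw [← LinearMap.range_eq_top, LinearMap.range_toSpanSingleton, hx₀]
  by_cases hk : LinearMap.ker φ = ⊥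
  · exact ⟨(LinearEquiv.ofBijective φ ⟨LinearMap.ker_eq_bot.mp hk, hφsurj⟩).symm⟩
  exfalso
  obtain ⟨f, hfk, hf0⟩ := (Submodule.ne_bot_iff _).mp hk
  have hfx : f • x₀ = 0 := by simpa [φ] using hfk
  obtain ⟨m, g, hfg, hg⟩ := IwasawaAlgebra.exists_eq_pow_mul_of_ne_zero p hf0
  have hgx : g • x₀ = 0 := by
    refine eq_zero_of_pow_smul_eq_zero_of_divisible h hdiv m ?_
    rw [smul_smul, ← hfg, hfx]
  -- `X/pX` is a quotient of `Λ/(g, p)`, hence finite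
  set P : Submodule (PowerSeries ℤ_[p]) X := Ideal.span {(p : PowerSeries ℤ_[p])} • ⊤ with hP
  haveI := finite_quotient_span_sup_span_natCast (p := p) hg
  have hker : Ideal.span {g} ⊔ Ideal.span {(p : PowerSeries ℤ_[p])} ≤ LinearMap.ker (P.mkQ ∘ₗ φ) := by
    refine sup_le ((Ideal.span_singleton_le_iff_mem _).mpr ?_) ((Ideal.span_singleton_le_iff_mem _).mpr ?_)
    · rw [LinearMap.mem_ker, LinearMap.comp_apply, LinearMap.toSpanSingleton_apply, hgx, map_zero]
    · rw [LinearMap.mem_ker, LinearMap.comp_apply, LinearMap.toSpanSingleton_apply, Submodule.mkQ_apply,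
        Submodule.Quotient.mk_eq_zero]
      exact Submodule.smul_mem_smul (Ideal.mem_span_singleton_self _) Submodule.mem_top
  have hfinQ : Finite (X ⧸ P) := by
    refine Finite.of_surjective ((Ideal.span {g} ⊔ Ideal.span {(p : PowerSeries ℤ_[p])}).liftQ (P.mkQ ∘ₗ φ) hker) ?_
    intro y
    obtain ⟨y', rfl⟩ := P.mkQ_surjective y
    obtain ⟨z, rfl⟩ := hφsurj y'
    exact ⟨Submodule.Quotient.mk z, rfl⟩
  -- `S[p] ≅ (X/pX)^∨` is then finite
  have hfg' : ∀ (x : X) (s : S), toDual ((p : PowerSeries ℤ_[p]) • x) s = toDual x ((p : AddMonoid.End S) s) := by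
    intro x s
    rw [Nat.cast_smul_eq_nsmul, nsmul_eval, AddMonoid.End.natCast_apply]
  have hfinS : Finite ↥(endInvariants (p : AddMonoid.End S)) := (h.finite_quotient_iff_of_smul hfg').mp hfinQ
  refine hinf ?_
  have e : {s : S | p • s = 0} = (endInvariants (p : AddMonoid.End S) : Set S) := by
    ext s
    rw [Set.mem_setOf_eq, SetLike.mem_coe, mem_endInvariants_iff, AddMonoid.End.natCast_apply]
  rw [e]
  exact Set.toFinite _

/-- **Same, with `S[𝔪]` exhibited inside the multiples of ONE `p`-torsion element** (the shape CYC⁺ delivers for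
`S = E⁺_∞ ⊗ ℚ_p/ℤ_p`: `(A/pA)^γ` lies in `ℤ·ē`): then `S[𝔪] ⊆ {k • e : k < p}` has at most `p` elements.
[cite: BDKim2007, Prop. 3.17] [cite: Kobayashi2003, Prop. 8.12] -/
theorem nonempty_linearEquiv_of_generator_of_divisible_of_infinite (h : IsDualPair p ψ toDual)
    {e : S} (he : p • e = 0) (hcyc : ∀ s : S, p • s = 0 → ψ s = 0 → ∃ k : ℕ, s = k • e)
    (hdiv : ∀ s : S, ∃ t : S, p • t = s) (hinf : {s : S | p • s = 0}.Infinite) :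
    Nonempty (X ≃ₗ[PowerSeries ℤ_[p]] PowerSeries ℤ_[p]) := by
  classical
  have hp : p.Prime := Fact.out
  -- `S[𝔪] ⊆ image of `Fin p` under `k ↦ k • e`
  have hsub : (piece p ψ 1 : Set S) ⊆ Set.range (fun k : Fin p ↦ (k : ℕ) • e) := by
    intro s hs
    have hs' : p ^ 1 • s = 0 ∧ (ψ ^ 1) s = 0 := hs
    rw [pow_one, pow_one] at hs'
    obtain ⟨k, rfl⟩ := hcyc s hs'.1 hs'.2
    refine ⟨⟨k % p, Nat.mod_lt k hp.pos⟩, ?_⟩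
    simp only
    exact IwasawaDual.mod_smul_eq he k
  have hfin : (piece p ψ 1 : Set S).Finite := (Set.finite_range _).subset hsub
  refine nonempty_linearEquiv_of_card_piece_le_of_divisible_of_infinite h hfin ?_ hdiv hinf
  haveI : Finite (piece p ψ 1) := hfin.to_subtype
  calc Nat.card (piece p ψ 1) = (piece p ψ 1 : Set S).ncard := (Nat.card_coe_set_eq _)
    _ ≤ (Set.range (fun k : Fin p ↦ (k : ℕ) • e)).ncard := Set.ncard_le_ncard hsub (Set.finite_range _)
    _ ≤ Nat.card (Fin p) := by
        rw [← Set.ncard_univ, ← Set.image_univ]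
        exact Set.ncard_image_le (Set.finite_univ)
    _ = p := Nat.card_fin p

end Summit.BirchSwinnertonDyer.BirchSwinnertonDyer.Theorems.ResidualThetaLayer.PlusDual

end
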